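import Mathlib

/-!
# Two exponent conversions for the dominant-term hypotheses (support, seat p1)

* `rpow_neg_le_two_rpow_mul` — a decay bound in the size itself converts to one in `1 + size`:
  `x^{−α} ≤ 2^α · (1 + x)^{−α}` for `x ≥ 1`, `α ≥ 0`.
* `mul_one_add_log_le` — a count `R · (1 + log R)` is polynomial of exponent `1 + ε` for every `ε > 0`:
  `R (1 + log R) ≤ (1 + 1/ε) · (1 + R)^{1+ε}` for `R ≥ 1` (`log R ≤ R^ε / ε`).

They make a decay `≲ size^{−α}` and a hyperbolic count `≲ R log R` fit the hypotheses `a_bound` (exponent `−α` in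
`1 + size`) and `count_bound` (exponent `β = 1 + ε`) of `T7SupportDominantTermPolynomial` verbatim; with `α = 3/2`
and `ε < 1/2` the exponent condition `α > β` holds.
Blind lane: Mathlib only; no sorry; axioms ⊆ {propext, Classical.choice, Quot.sound}.
-/

namespace Summit.Ventures.HodgeRepro2.T7SupportExponentGlue

/-- `x^{−α} ≤ 2^α (1 + x)^{−α}` for `x ≥ 1`, `α ≥ 0` (since `1 + x ≤ 2 x`). -/
theorem rpow_neg_le_two_rpow_mul {x α : ℝ} (hx : 1 ≤ x) (hα : 0 ≤ α) :
    x ^ (-α) ≤ (2 : ℝ) ^ α * (1 + x) ^ (-α) := by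
  have hx0 : 0 < x := by linarith
  have h1x : 0 < 1 + x := by linarith
  -- `(1 + x)^α ≤ (2x)^α = 2^α x^α`
  have h : (1 + x) ^ α ≤ (2 : ℝ) ^ α * x ^ α := by
    rw [← Real.mul_rpow (by norm_num) hx0.le]
    exact Real.rpow_le_rpow h1x.le (by linarith) hα
  rw [Real.rpow_neg hx0.le, Real.rpow_neg h1x.le]
  have hxα : 0 < x ^ α := Real.rpow_pos_of_pos hx0 α
  have h1α : 0 < (1 + x) ^ α := Real.rpow_pos_of_pos h1x α
  rw [← div_eq_mul_inv, le_div_iff₀ h1α, inv_mul_eq_div, div_le_iff₀ hxα]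
  linarith

/-- `R (1 + log R) ≤ (1 + 1/ε) (1 + R)^{1+ε}` for `R ≥ 1`, `ε > 0`. -/
theorem mul_one_add_log_le {R ε : ℝ} (hR : 1 ≤ R) (hε : 0 < ε) :
    R * (1 + Real.log R) ≤ (1 + 1 / ε) * (1 + R) ^ (1 + ε) := by
  have hR0 : 0 ≤ R := by linarith
  have hlog : Real.log R ≤ R ^ ε / ε := Real.log_le_rpow_div hR0 hε
  have h1 : R ≤ (1 + R) ^ (1 + ε) := by
    calc R ≤ 1 + R := by linarith
      _ = (1 + R) ^ (1 : ℝ) := (Real.rpow_one _).symm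
      _ ≤ (1 + R) ^ (1 + ε) := Real.rpow_le_rpow_of_exponent_le (by linarith) (by linarith)
  have h2 : R * R ^ ε ≤ (1 + R) ^ (1 + ε) := by
    calc R * R ^ ε = R ^ (1 + ε) := by
          rw [Real.rpow_add (by linarith : (0 : ℝ) < R), Real.rpow_one]
      _ ≤ (1 + R) ^ (1 + ε) := Real.rpow_le_rpow hR0 (by linarith) (by linarith)
  have hε' : 0 ≤ 1 / ε := by positivity
  calc R * (1 + Real.log R) ≤ R * (1 + R ^ ε / ε) := by
        gcongr
    _ = R + (1 / ε) * (R * R ^ ε) := by ring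
    _ ≤ (1 + R) ^ (1 + ε) + (1 / ε) * (1 + R) ^ (1 + ε) := by
        gcongr
    _ = (1 + 1 / ε) * (1 + R) ^ (1 + ε) := by ring

end Summit.Ventures.HodgeRepro2.T7SupportExponentGlue
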